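import Summits.Ventures.CertifiedManyBodySolver.Upper.PartialParticleHoleInvolution
import Summits.Ventures.CertifiedManyBodySolver.Upper.DWaveSourceOpenBoxParticleHole
import HarnessLib

/-!
# The producers' transformed Hamiltonian `H̃ = Sᴴ A_C S` of the sourced open box in closed form

HONEST FRAMING: first certified bounds; not a superconductivity verdict. Nothing here is a number or a row. With
`A_C = dWaveSourceOpenBox a b U μ h` (pin-1's open `a × b` box with the `d`-wave pair source) and the gauged Shiba frames
of `SourcedBoxNodeOfGaugedWitness.lean` (`W = partialParticleHole D↓`, `G = orbitalPhase g`, `|g i| = 1`), we push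
the IRD desk's `partialParticleHole_conj_dWaveSourceOpenBox` (`W A_C Wᴴ = dΓ(𝓗) − μ·ab·1 + U(N↑ − Σ n↑n↓)`,
`𝓗 = bdgNambuMatrix (−[p∼q]) (−h·w_C) μ`) through the diagonal gauge:

* `orbitalPhase_conj_dGamma`: `G dΓ(M) Gᴴ = dΓ(M^g)`, `M^g_{ij} = g_i ḡ_j M_{ij}` (gauge covariance of second quantisation);
* `orbitalPhase_conj_numberOp`, `orbitalPhase_conj_numberOp_mul_numberOp`: densities and double occupancies are gauge invariant;
* **`gaugedShiba_conj_dWaveSourceOpenBox`**: `(G W) A_C (G W)ᴴ = dΓ(𝓗^g) − μ·ab·1 + U(N↑ − Σ_p n_{p↑}n_{p↓})`;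
* **`gaugedShiba'_conjTranspose_conj_dWaveSourceOpenBox`**: for the frame `S' = W · G` the READERS' operator
  `H̃ = S'ᴴ A_C S'` (FORMAT-mpsgf1: `H` in the basis `S'|s⟩`) `= dΓ(𝓗^{ḡ}) − μ·ab·1 + U(N↑ − Σ_p n_{p↑}n_{p↓})` — an
  explicitly particle-NUMBER-CONSERVING operator (one-body `dΓ` + density–density), for every box, every real `U, μ, h`
  and every phase function; the producers' frame is `g(r↓) = (−1)^{x+y}`, `g(r↑) = 1`.
Written by the IRD desk (sr-mbsolver-ird-5); nothing of pin-1's / var-10's files is touched.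
-/

noncomputable section
namespace Summit.Ventures.CertifiedManyBodySolver
open Matrix Finset Literature.Probability.LatticeModels
open Literature.MathematicalPhysics.QuantumLattice Literature.Barriers.HubbardSuperconductivity HubbardWave0
open scoped ComplexOrder ComplexConjugate

section GaugeCovariance

variable {ι : Type*} [LinearOrder ι] [Fintype ι]

/-- **Gauge covariance of second quantisation**: `G dΓ(M) Gᴴ = dΓ(M^g)` with `M^g_{ij} = g_i (g_j)^* M_{ij}`.
[cite: Lieb1994, p. 3] -/
theorem orbitalPhase_conj_dGamma {g : ι → ℂ} (hg : ∀ i, ‖g i‖ = 1) (M : Matrix ι ι ℂ) :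
    orbitalPhase g * dGamma M * (orbitalPhase g)ᴴ = dGamma (Matrix.of fun i j => g i * star (g j) * M i j) := by
  rw [← orbitalPhaseAut_apply hg, dGamma_eq, dGamma_eq, map_sum]
  refine Finset.sum_congr rfl fun i _ => ?_
  rw [map_sum]
  refine Finset.sum_congr rfl fun j _ => ?_
  rw [map_smul, orbitalPhaseAut_creation_mul_annihilation hg, smul_smul, Matrix.of_apply, mul_comm (M i j)]

variable {Λ : Type*} [LinearOrder Λ] [Fintype Λ]

/-- Densities are gauge invariant: `G n_{xσ} Gᴴ = n_{xσ}`. [folklore] -/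
theorem orbitalPhase_conj_numberOp {g : Orb Λ → ℂ} (hg : ∀ i, ‖g i‖ = 1) (x : Λ) (σ : Fin 2) :
    orbitalPhase g * numberOp x σ * (orbitalPhase g)ᴴ = numberOp x σ := by
  rw [← orbitalPhaseAut_apply hg]
  exact orbitalPhaseAut_numberAt hg (orb x σ)

/-- Double occupancies are gauge invariant: `G (n_{x↑} n_{x↓}) Gᴴ = n_{x↑} n_{x↓}`. [folklore] -/
theorem orbitalPhase_conj_numberOp_mul_numberOp {g : Orb Λ → ℂ} (hg : ∀ i, ‖g i‖ = 1) (x : Λ) :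
    orbitalPhase g * (numberOp x 0 * numberOp x 1) * (orbitalPhase g)ᴴ = numberOp x 0 * numberOp x 1 := by
  rw [← orbitalPhaseAut_apply hg, map_mul, orbitalPhaseAut_apply hg, orbitalPhaseAut_apply hg,
    orbitalPhase_conj_numberOp hg, orbitalPhase_conj_numberOp hg]

end GaugeCovariance

section SourcedBox

variable (a b : ℕ)

/-- **The gauged Shiba transform of the sourced open box**: for `S = orbitalPhase g · partialParticleHole D↓`,
`S · dWaveSourceOpenBox a b U μ h · Sᴴ = dΓ(𝓗^g) − μ·(ab)·1 + U (N↑ − Σ_p n_{p↑}n_{p↓})` with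
`𝓗^g_{ij} = g_i ḡ_j 𝓗_{ij}`, `𝓗 = bdgNambuMatrix (−[p∼q]) (−h·w_C) μ` — number-conserving for every phase function.
[cite: Lieb1989, proof of Theorem 2] -/
theorem gaugedShiba_conj_dWaveSourceOpenBox (U μ h : ℝ) {g : Orb (Fin a ×ₗ Fin b) → ℂ} (hg : ∀ i, ‖g i‖ = 1) :
    orbitalPhase g * partialParticleHole (spinDownOrbitals : Finset (Orb (Fin a ×ₗ Fin b))) *
        dWaveSourceOpenBox a b U μ h *
        (orbitalPhase g * partialParticleHole (spinDownOrbitals : Finset (Orb (Fin a ×ₗ Fin b))))ᴴ =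
      dGamma (Matrix.of fun i j => g i * star (g j) *
          bdgNambuMatrix
            (fun x y : Fin a ×ₗ Fin b => if (rectBoxGraph a b).Adj x y then -(1 : ℂ) else 0)
            (fun u v : Fin a ×ₗ Fin b => -(h : ℂ) * dWaveBoxPairWeight a b (u, v)) μ i j) -
        ((μ : ℂ) * ((a : ℂ) * (b : ℂ))) •
          (1 : Matrix (Finset (Orb (Fin a ×ₗ Fin b))) (Finset (Orb (Fin a ×ₗ Fin b))) ℂ) +
        (U : ℂ) • ((∑ x : Fin a ×ₗ Fin b, numberOp x 0) -
          ∑ x : Fin a ×ₗ Fin b, numberOp x 0 * numberOp x 1) := by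
  rw [gaugedShiba_conj_eq, partialParticleHole_conj_dWaveSourceOpenBox, ← orbitalPhaseAut_apply hg]
  simp only [map_add, map_sub, map_smul, map_sum, map_mul]
  simp only [orbitalPhaseAut_apply hg, orbitalPhase_conj_dGamma hg, orbitalPhase_conj_numberOp hg, Matrix.mul_one,
    orbitalPhase_mul_conjTranspose hg]

/-- **The readers' transformed Hamiltonian in closed form.** For the frame `S' = partialParticleHole D↓ · orbitalPhase g`
(`|g i| = 1`; the producers' `g(r↓) = (−1)^{x+y}`, `g(r↑) = 1`), the operator whose Rayleigh quotients an exact reader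
certifies, `H̃ = S'ᴴ · dWaveSourceOpenBox a b U μ h · S'`, equals `dΓ(𝓗^{ḡ}) − μ·(ab)·1 + U (N↑ − Σ_p n_{p↑}n_{p↓})`,
`𝓗^{ḡ}_{ij} = ḡ_i g_j 𝓗_{ij}`: one-body plus density–density, hence particle-number conserving — the structural fact
behind reading a certificate in a fixed transformed-particle-number sector (FORMAT-mpsgf1 §2).
[cite: Lieb1989, proof of Theorem 2] -/
theorem gaugedShiba'_conjTranspose_conj_dWaveSourceOpenBox (U μ h : ℝ) {g : Orb (Fin a ×ₗ Fin b) → ℂ}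
    (hg : ∀ i, ‖g i‖ = 1) :
    (partialParticleHole (spinDownOrbitals : Finset (Orb (Fin a ×ₗ Fin b))) * orbitalPhase g)ᴴ *
        dWaveSourceOpenBox a b U μ h *
        (partialParticleHole (spinDownOrbitals : Finset (Orb (Fin a ×ₗ Fin b))) * orbitalPhase g) =
      dGamma (Matrix.of fun i j => star (g i) * g j *
          bdgNambuMatrix
            (fun x y : Fin a ×ₗ Fin b => if (rectBoxGraph a b).Adj x y then -(1 : ℂ) else 0)
            (fun u v : Fin a ×ₗ Fin b => -(h : ℂ) * dWaveBoxPairWeight a b (u, v)) μ i j) -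
        ((μ : ℂ) * ((a : ℂ) * (b : ℂ))) •
          (1 : Matrix (Finset (Orb (Fin a ×ₗ Fin b))) (Finset (Orb (Fin a ×ₗ Fin b))) ℂ) +
        (U : ℂ) • ((∑ x : Fin a ×ₗ Fin b, numberOp x 0) -
          ∑ x : Fin a ×ₗ Fin b, numberOp x 0 * numberOp x 1) := by
  set W := partialParticleHole (spinDownOrbitals : Finset (Orb (Fin a ×ₗ Fin b))) with hW
  set A := dWaveSourceOpenBox a b U μ h with hA
  have hGt : (orbitalPhase (star ∘ g))ᴴ = orbitalPhase g := by
    rw [conjTranspose_orbitalPhase]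
    congr 1
    funext i
    simp only [Function.comp_apply, star_star]
  -- `(W G)ᴴ A (W G) = Ḡ (Wᴴ A W) Ḡᴴ = Ḡ (W A Wᴴ) Ḡᴴ = (Ḡ W) A (Ḡ W)ᴴ`, `Ḡ = orbitalPhase (star ∘ g)`
  have e : (W * orbitalPhase g)ᴴ * A * (W * orbitalPhase g) =
      orbitalPhase (star ∘ g) * W * A * (orbitalPhase (star ∘ g) * W)ᴴ := by
    rw [conjTranspose_mul, conjTranspose_mul, conjTranspose_orbitalPhase g, hGt]
    calc orbitalPhase (star ∘ g) * Wᴴ * A * (W * orbitalPhase g)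
        = orbitalPhase (star ∘ g) * (Wᴴ * A * W) * orbitalPhase g := by simp only [Matrix.mul_assoc]
      _ = orbitalPhase (star ∘ g) * (W * A * Wᴴ) * orbitalPhase g := by
          rw [hW, partialParticleHole_conjTranspose_conj_eq]
      _ = orbitalPhase (star ∘ g) * W * A * (Wᴴ * orbitalPhase g) := by simp only [Matrix.mul_assoc]
  rw [e, hW, hA, gaugedShiba_conj_dWaveSourceOpenBox a b U μ h (norm_star_phase hg)]
  congr 3
  funext i j
  simp only [Function.comp_apply, star_star]

end SourcedBox
end Summit.Ventures.CertifiedManyBodySolver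
end
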